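import Mathlib.AlgebraicGeometry.Morphisms.ClosedImmersion
import Mathlib.AlgebraicGeometry.Noetherian
import Mathlib.AlgebraicGeometry.Stalk
import Mathlib.RingTheory.Filtration
import HarnessLib

/-!
# A closed subscheme through which all infinitesimal neighbourhoods of all points factor is everything (Krull)

Layer `Literature/AlgebraicGeometry/Morphisms`, namespace `Literature.AlgebraicGeometry.Morphisms`.  THEOREMS ONLY (no definition,
no named fact, no instance, no notation).  Cell `hodgecm-mathlib` (D-0151), F-2d road (R-def) «theorem of the cube over a
NON-reduced base by Artinian induction», brick D3″ (author B-p07 (g16)): Step (II) of [GortzWedhorn2023] Lemma 24.72 REPLACED,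
for the cube, by the seesaw closed subscheme (★ `Motives/SeesawRelative*`, [MumfordAV1970] §10) plus KRULL's intersection theorem.

Let `i : Z → W` be a closed immersion into a locally noetherian scheme and suppose that for every point `t ∈ W` and every `n` the
`n`-th infinitesimal neighbourhood `Spec(𝒪_{W,t}/𝔪_t^{n+1}) → W` of `t` factors through `i`.  Then `i` is an isomorphism: a local
section of the ideal of `Z` has, at every point `t`, a germ lying in `𝔪_t^{n+1}` for all `n` (the factorisation kills it in
`𝒪_{W,t}/𝔪_t^{n+1}`, read through Mathlib's `stalkClosedPointTo`), hence in `⋂_n 𝔪_t^n = 0` (Krull, Mathlib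
`Ideal.iInf_pow_eq_bot_of_isLocalRing`), so the section is `0` (Mathlib `TopCat.Presheaf.section_ext`); a closed immersion with zero
ideal is an isomorphism (Mathlib `IsClosedImmersion.isIso_iff_ker_eq_bot`).  In the cube: `W = T`, `Z = Z₀` the seesaw subscheme of a
line bundle on `A ×_S A ×_S T → T`, and the factorisations are Step (I) (★ `Morphisms/CechUnitCocycleTwoFaceTower`) — so the bundle is
pulled back from `T` with no appeal to the theorem on formal functions.

* `isLocalHom_quotient_mk_maximalIdeal_pow` — `𝒪 → 𝒪/𝔪^{n+1}` is a local homomorphism (so `Spec` of it hits the closed point);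
* `germ_mem_maximalIdeal_pow_of_factors` — a kernel section has germ in `𝔪_t^{n+1}` if the `n`-th infinitesimal neighbourhood of `t` factors;
* `germ_eq_zero_of_forall_factors` — hence germ `0` (Krull);
* **`IsClosedImmersion.isIso_of_forall_infinitesimal_factors`** — the statement.

HC_CM is proved only modulo the 7 printed citations until rung 0 closes; nothing here is about HC.

## References
* [GortzWedhorn2023] U. Görtz, T. Wedhorn, *Algebraic Geometry II* (2023), Lemma 24.72 proof Step (II) (p. 409) (what this replaces).
* [MumfordAV1970] D. Mumford, *Abelian Varieties* (1970), §10, the seesaw theorem over a base (the closed subscheme `Z₀`).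
* [AtiyahMacdonald1969] M. Atiyah, I. Macdonald, *Introduction to Commutative Algebra* (1969), Cor. 10.20 (Krull's intersection theorem).
* [StacksProject] The Stacks Project, Tag 01QN (closed immersions and ideal sheaves), Tag 00IP (Krull's intersection theorem).
-/

noncomputable section

universe u

open CategoryTheory AlgebraicGeometry IsLocalRing TopologicalSpace Opposite

namespace Literature.AlgebraicGeometry.Morphisms

variable {W : Scheme.{u}}

/-- **`𝒪 → 𝒪/𝔪^{n+1}` is a local homomorphism** of local rings (a unit modulo `𝔪^{n+1} ⊆ 𝔪` is a unit).
[cite: AtiyahMacdonald1969, Prop. 1.9 and Cor. 10.20 (setting)] -/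
theorem isLocalHom_quotient_mk_maximalIdeal_pow (O : Type u) [CommRing O] [IsLocalRing O] (n : ℕ) :
    IsLocalHom (Ideal.Quotient.mk (maximalIdeal O ^ (n + 1))) := by
  refine ⟨fun a ha => ?_⟩
  obtain ⟨u, hu⟩ := ha
  obtain ⟨b, hb⟩ := Ideal.Quotient.mk_surjective (↑u⁻¹ : O ⧸ maximalIdeal O ^ (n + 1))
  have h1 : Ideal.Quotient.mk (maximalIdeal O ^ (n + 1)) (a * b) = 1 := by
    rw [map_mul, ← hu, hb, Units.mul_inv]
  have h2 : a * b - 1 ∈ maximalIdeal O := by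
    have : a * b - 1 ∈ maximalIdeal O ^ (n + 1) := by
      rw [← Ideal.Quotient.eq_zero_iff_mem, map_sub, h1, map_one, sub_self]
    exact Ideal.pow_le_self (Nat.succ_ne_zero n) this
  by_contra hna
  have ha' : a ∈ maximalIdeal O := (IsLocalRing.mem_maximalIdeal a).2 hna
  have : (1 : O) ∈ maximalIdeal O := by
    have h3 : a * b ∈ maximalIdeal O := Ideal.mul_mem_right b _ ha'
    simpa using (maximalIdeal O).sub_mem h3 h2
  exact (IsLocalRing.maximalIdeal.isMaximal O).ne_top ((Ideal.eq_top_iff_one _).2 this)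

/-- **A kernel section has germ in `𝔪_t^{n+1}` when the `n`-th infinitesimal neighbourhood of `t` factors through the closed
subscheme**: if `Spec(𝒪_{W,t}/𝔪^{n+1}) → W` factors as `v ≫ i`, then the ideal of `i` is contained in the kernel of that morphism
(Mathlib `Scheme.Hom.le_ker_comp`), which on germs at `t` is computed by Mathlib's `stalkClosedPointTo` = the quotient map.
[cite: StacksProject, Tag 01QN] -/
theorem germ_mem_maximalIdeal_pow_of_factors {Z : Scheme.{u}} (i : Z ⟶ W) (t : W) (n : ℕ)
    (v : Spec (.of (W.presheaf.stalk t ⧸ maximalIdeal (W.presheaf.stalk t) ^ (n + 1))) ⟶ Z)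
    (hv : v ≫ i = Spec.map (CommRingCat.ofHom (Ideal.Quotient.mk (maximalIdeal (W.presheaf.stalk t) ^ (n + 1)))) ≫
      W.fromSpecStalk t)
    (U : W.affineOpens) (ht : t ∈ (U : W.Opens)) (s : Γ(W, U)) (hs : s ∈ i.ker.ideal U) :
    W.presheaf.germ U t ht s ∈ maximalIdeal (W.presheaf.stalk t) ^ (n + 1) := by
  -- the Artinian local ring `𝒪/𝔪^{n+1}` and the local surjection onto it
  have hJ : maximalIdeal (W.presheaf.stalk t) ^ (n + 1) ≠ ⊤ := fun h =>
    (IsLocalRing.maximalIdeal.isMaximal _).ne_top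
      (top_le_iff.1 (h.symm.le.trans (Ideal.pow_le_self (Nat.succ_ne_zero n))))
  haveI : Nontrivial (↑(W.presheaf.stalk t) ⧸ maximalIdeal ↑(W.presheaf.stalk t) ^ (n + 1)) :=
    Ideal.Quotient.nontrivial_iff.mpr hJ
  haveI : IsLocalRing (↑(W.presheaf.stalk t) ⧸ maximalIdeal ↑(W.presheaf.stalk t) ^ (n + 1)) :=
    IsLocalRing.of_surjective' (Ideal.Quotient.mk _) Ideal.Quotient.mk_surjective
  haveI : IsLocalHom (CommRingCat.ofHom (Ideal.Quotient.mk (maximalIdeal ↑(W.presheaf.stalk t) ^ (n + 1)))).hom :=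
    isLocalHom_quotient_mk_maximalIdeal_pow _ n
  -- the ideal of `i` dies under `g = Spec(𝒪/𝔪^{n+1}) → W`
  have hker : i.ker ≤ (Spec.map (CommRingCat.ofHom (Ideal.Quotient.mk (maximalIdeal (W.presheaf.stalk t) ^ (n + 1)))) ≫
      W.fromSpecStalk t).ker := by
    rw [← hv]; exact Scheme.Hom.le_ker_comp v i
  have hs0 : ((Spec.map (CommRingCat.ofHom (Ideal.Quotient.mk (maximalIdeal (W.presheaf.stalk t) ^ (n + 1)))) ≫
      W.fromSpecStalk t).app U).hom s = 0 :=
    Scheme.Hom.ideal_ker_le _ U ((Scheme.IdealSheafData.le_def.1 hker) U hs)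
  -- the closed point goes to `t`
  have hgt : (Spec.map (CommRingCat.ofHom (Ideal.Quotient.mk (maximalIdeal (W.presheaf.stalk t) ^ (n + 1)))) ≫
      W.fromSpecStalk t) (closedPoint _) ∈ (U : W.Opens) := by
    rw [Scheme.Hom.comp_apply, Spec_closedPoint, Scheme.fromSpecStalk_closedPoint]
    exact ht
  -- germ then quotient = `g^*` then evaluation
  have key := (Scheme.germ_stalkClosedPointTo_Spec_fromSpecStalk
    (CommRingCat.ofHom (Ideal.Quotient.mk (maximalIdeal (W.presheaf.stalk t) ^ (n + 1)))) U hgt).symm.trans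
    (Scheme.germ_stalkClosedPointTo (Spec.map (CommRingCat.ofHom (Ideal.Quotient.mk
      (maximalIdeal (W.presheaf.stalk t) ^ (n + 1)))) ≫ W.fromSpecStalk t) U hgt)
  have key' := congrArg (fun φ => φ.hom s) key
  simp only [CommRingCat.hom_comp, RingHom.coe_comp, Function.comp_apply] at key'
  rw [hs0, map_zero] at key'
  exact Ideal.Quotient.eq_zero_iff_mem.1 key'

/-- **… hence germ `0`** when this holds for every `n` (Krull's intersection theorem `⋂_n 𝔪^n = 0` in the noetherian local ring
`𝒪_{W,t}`, Mathlib `Ideal.iInf_pow_eq_bot_of_isLocalRing`). [cite: AtiyahMacdonald1969, Cor. 10.20] [cite: StacksProject, Tag 00IP] -/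
theorem germ_eq_zero_of_forall_factors [IsLocallyNoetherian W] {Z : Scheme.{u}} (i : Z ⟶ W) (t : W)
    (h : ∀ n : ℕ, ∃ v : Spec (.of (W.presheaf.stalk t ⧸ maximalIdeal (W.presheaf.stalk t) ^ (n + 1))) ⟶ Z,
      v ≫ i = Spec.map (CommRingCat.ofHom (Ideal.Quotient.mk (maximalIdeal (W.presheaf.stalk t) ^ (n + 1)))) ≫
        W.fromSpecStalk t)
    (U : W.affineOpens) (ht : t ∈ (U : W.Opens)) (s : Γ(W, U)) (hs : s ∈ i.ker.ideal U) :
    W.presheaf.germ U t ht s = 0 := by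
  have hmem : W.presheaf.germ U t ht s ∈ ⨅ n : ℕ, maximalIdeal (W.presheaf.stalk t) ^ n := by
    refine Submodule.mem_iInf _ |>.2 fun n => ?_
    cases n with
    | zero => rw [pow_zero, Ideal.one_eq_top]; exact Submodule.mem_top
    | succ n =>
      obtain ⟨v, hv⟩ := h n
      exact germ_mem_maximalIdeal_pow_of_factors i t n v hv U ht s hs
  rwa [Ideal.iInf_pow_eq_bot_of_isLocalRing _ (IsLocalRing.maximalIdeal.isMaximal _).ne_top, Ideal.mem_bot] at hmem

/-- **A CLOSED SUBSCHEME THROUGH WHICH ALL INFINITESIMAL NEIGHBOURHOODS OF ALL POINTS FACTOR IS EVERYTHING**: for a closed immersion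
`i : Z → W` into a locally noetherian scheme, if `Spec(𝒪_{W,t}/𝔪^{n+1}) → W` factors through `i` for every `t` and `n`, then `i` is
an isomorphism (its ideal has all germs in `⋂ 𝔪^n = 0`).  Used with `Z = ` the seesaw subscheme of a line bundle on
`A ×_S A ×_S T → T` and the factorisations given by Step (I) of [GortzWedhorn2023] Lemma 24.72, in place of Step (II).
[cite: MumfordAV1970, §10 (seesaw theorem, the closed subscheme)] [cite: GortzWedhorn2023, Lemma 24.72 proof Step (II) (p. 409)] -/
theorem IsClosedImmersion.isIso_of_forall_infinitesimal_factors [IsLocallyNoetherian W] {Z : Scheme.{u}} (i : Z ⟶ W)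
    [IsClosedImmersion i]
    (h : ∀ (t : W) (n : ℕ), ∃ v : Spec (.of (W.presheaf.stalk t ⧸ maximalIdeal (W.presheaf.stalk t) ^ (n + 1))) ⟶ Z,
      v ≫ i = Spec.map (CommRingCat.ofHom (Ideal.Quotient.mk (maximalIdeal (W.presheaf.stalk t) ^ (n + 1)))) ≫
        W.fromSpecStalk t) :
    IsIso i := by
  refine IsClosedImmersion.isIso_iff_ker_eq_bot.2 (le_antisymm (Scheme.IdealSheafData.le_def.2 fun U => ?_) bot_le)
  intro s hs
  have hs0 : s = 0 := TopCat.Presheaf.section_ext W.sheaf _ s 0 fun x hx => by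
    rw [map_zero]
    exact germ_eq_zero_of_forall_factors i x (h x) U hx s hs
  rw [hs0]
  exact Submodule.zero_mem _

end Literature.AlgebraicGeometry.Morphisms

end
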